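import Summits.ValiantsHypothesis.ValiantsHypothesis.Theses.DefinabilityGap
import Summits.ValiantsHypothesis.ValiantsHypothesis.Theorems.DefinabilityGapK2cProjRung

/-!
# DefinabilityGap — what the residual crux K1 costs: `KIPlantedHitting ⟹ VPSPACE_b ⊄ VP`
# (Chatterjee–Tengse Thm. 4.1 (i) for the planted Kabanets–Impagliazzo map, kernel form)

Route `DefinabilityGap` (`Theses/DefinabilityGap.lean`). Its residual crux K1 `KIPlantedHitting`
(`stmt-ValiantsHypothesis-23547`: the planted permanent map `G_m = kiPer m` is an i.o. hitting-set generator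
against polynomial-size, polynomial-degree circuits) is declared RESIDUAL / leaf BARRIER ("an explicit
superpolynomial general-circuit lower bound; implies `VPSPACE⁰_b ⊄ VP_ℂ` by CT23 Thm 3.1", its docstring). This
file makes the quoted placement a KERNEL THEOREM, up to the extraction of constants: with rung 3 of the attacked
crux K2c (`DefinabilityGapK2cProjRung.k2c_proj_rung`: an UNCONDITIONAL p-family `A` of annihilators of `G_m`
computed by fan-in-two circuits with projection gates of p-bounded size over p-bounded bound workspace —
Chatterjee–Tengse's `VPSPACE_b` over `ℂ` with constants, Def. 2.22), K1 forces `A ∉ VP_ℂ`: were `A ∈ VP`, its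
size and degree would be `≤ m^c + c ≤ q(m)^{c+1}` (`q(m) ≥ m² + 1`), so K1 at level `b = c + 1` supplies
arbitrarily large `m` at which every such nonzero polynomial — in particular `A_m` — is NOT annihilated by
`G_m`, contradicting `A_m ∘ G_m = 0`. Hence **`KIPlantedHitting → (projection-circuit `VPSPACE_b` over ℂ) ⊄ VP_ℂ`**
(`exists_projFamily_not_isVPFamily_of_kiPlantedHitting`) — the tree's
`exists_projFamily_not_isVPFamily_of_encodedHittingSetGenerators` (CT23 Thm. 4.1 (i)) for this one explicit
generator, with the i.o. hitting of K1 in place of eventual hitting against all levels.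

Honest framing: a CONSEQUENCE of the open crux K1 (placing it: at least as strong as separating `VP_ℂ` from
constant-full bounded-degree `VPSPACE` with projection gates — itself open); nothing here is a lower bound and
`VP ≠ VNP` is NOT proved. The hypothesis is the route item; the conclusion is not an item (no item is closed).

## References

* [ChatterjeeTengse2023] P. Chatterjee, A. Tengse, *Lower Bounds from Succinct Hitting Sets*, arXiv:2309.07612v2,
  Thm. 3.1, Thm. 4.1 (i), Def. 2.22.
* [KabanetsImpagliazzo2003] V. Kabanets, R. Impagliazzo, STOC 2003, Thm. 7.7.
* [KoiranPerifel2009] P. Koiran, S. Perifel, *VPSPACE and a transfer theorem over the reals*, Comput. Complexity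
  18 (2009) (the Boolean entanglement of `VP` vs `VPSPACE_b`).
-/

noncomputable section

open MvPolynomial
open Literature.Computability.AlgebraicComplexity
open Literature.Barriers.ValiantsHypothesis
open Summit.ValiantsHypothesis.ValiantsHypothesis.Theorems.DefinabilityGapAffineRung (qOf qOf_spec sq_le_qOf kiPer)
open Summit.ValiantsHypothesis.ValiantsHypothesis.Theses.DefinabilityGap (KIPlantedHitting)

namespace Summit.ValiantsHypothesis.ValiantsHypothesis.Theorems.DefinabilityGapK1SeparatesProj

/-- `m^c + c ≤ q(m)^(c+1)`: polynomial bounds in `m` are polynomial bounds in `q(m) ≥ m² + 1 ≥ 2`. [folklore] -/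
theorem pow_add_le_qOf_pow (m c : ℕ) : m ^ c + c ≤ qOf m ^ (c + 1) := by
  have hq : m * m + 1 ≤ qOf m := (qOf_spec m).1
  have hq2 : 2 ≤ qOf m := (qOf_spec m).2.two_le
  have hmq : m ≤ qOf m := by nlinarith
  have h1 : m ^ c ≤ qOf m ^ c := Nat.pow_le_pow_left hmq c
  have h2 : c ≤ qOf m ^ c :=
    (Nat.lt_pow_self (by omega : 1 < 2)).le.trans (Nat.pow_le_pow_left hq2 c)
  calc m ^ c + c ≤ qOf m ^ c + qOf m ^ c := add_le_add h1 h2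
    _ = 2 * qOf m ^ c := by ring
    _ ≤ qOf m * qOf m ^ c := Nat.mul_le_mul_right _ hq2
    _ = qOf m ^ (c + 1) := by ring

/-- **`KIPlantedHitting ⟹ VPSPACE_b(ℂ, projection gates) ⊄ VP_ℂ`.** If the planted Kabanets–Impagliazzo permanent
map is an i.o. hitting-set generator against `VP`-size, `VP`-degree adversaries (crux K1 of route DefinabilityGap),
then the unconditional projection-circuit annihilator family of rung 3 (`k2c_proj_rung`) is a p-family with
fan-in-two projection circuits of p-bounded size over p-bounded bound workspace which is NOT in `VP_ℂ`.
[cite: ChatterjeeTengse2023, Thm. 4.1 (i) with Thm. 3.1; KabanetsImpagliazzo2003, Thm. 7.7] -/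
theorem exists_projFamily_not_isVPFamily_of_kiPlantedHitting (hK1 : KIPlantedHitting) :
    ∃ (A : ∀ m : ℕ, MvPolynomial (Fin 3 → Fin (qOf m)) ℂ) (t : ℕ → ℕ)
      (Cq : ∀ m, ProjCircuit ℂ ((Fin 3 → Fin (qOf m)) ⊕ Fin (t m))),
      IsPFamily A ∧ IsPBounded t ∧
        (∀ m, (Cq m).IsFanInTwo ∧ (Cq m).Computes (rename Sum.inl (A m))) ∧
        IsPBounded (fun m => (Cq m).size) ∧ ¬ IsVPFamily A := by
  obtain ⟨A, t, Cq, hA, ht, hC, hsize, m₁, hann⟩ := DefinabilityGapK2cProjRung.k2c_proj_rung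
  refine ⟨A, t, Cq, hA, ht, hC, hsize, fun hVP => ?_⟩
  obtain ⟨c₁, hc₁⟩ := hVP.2
  obtain ⟨c₂, hc₂⟩ := hVP.1.2
  -- level `b := max c₁ c₂ + 1` of K1, beyond the annihilation threshold `m₁`
  obtain ⟨m, hm, hhit⟩ := hK1 (max c₁ c₂ + 1) m₁
  have hq1 : 1 ≤ qOf m := (qOf_spec m).2.one_lt.le
  have hmono : ∀ c, c ≤ max c₁ c₂ → qOf m ^ (c + 1) ≤ qOf m ^ (max c₁ c₂ + 1) := fun c hc =>
    Nat.pow_le_pow_right hq1 (by omega)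
  have hcx : complexity (A m) ≤ qOf m ^ (max c₁ c₂ + 1) :=
    ((hc₁ m).trans (pow_add_le_qOf_pow m c₁)).trans (hmono c₁ (le_max_left _ _))
  have hdeg : (A m).totalDegree ≤ qOf m ^ (max c₁ c₂ + 1) :=
    ((hc₂ m).trans (pow_add_le_qOf_pow m c₂)).trans (hmono c₂ (le_max_right _ _))
  exact hhit (A m) (hann m hm).1 hcx hdeg (hann m hm).2

end Summit.ValiantsHypothesis.ValiantsHypothesis.Theorems.DefinabilityGapK1SeparatesProj

end
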